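import Summits.Ventures.HodgeRepro2.T5SU11CoefficientPow
import Summits.Ventures.HodgeRepro2.T5U11Product

/-!
# The `L²`- and `L^p`-integrals of the matrix coefficient over `U(1,1) = Z · SU(1,1)`

The support map's P3 integrates `|⟨π(g) f, f⟩|²` over `H_j = U(1,1)`: «since the central `z` acts
by a unitary scalar, `|⟨π(zg)f,f⟩| = |⟨π(g)f,f⟩|`, and `Z_j × SU(1,1) → U(1,1)` is `2 : 1`,
`∫_{U(1,1)} = (vol Z_j / 2) ∫_{SU(1,1)}`».  Here, with the disc-picture coefficient
`(1 - |g·0|²)^{3p/2}` on `U(1,1)` (invariant under the scalar circle: scalars act trivially on the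
disc), the product formula `T5U11Product.integral_eq_of_scalar_invariant` and
`T5SU11CoefficientPow` give, for every Haar measure `μU` on `U(1,1)` and every `p > 2/3`: the
coefficient is `μU`-integrable and `c_U • ∫_{U(1,1)} (1 - |g·0|²)^{3p/2} dμU = 2π / (3p - 2)` — an
explicit POSITIVE number (the «`Z > 0`» of P3 at `p = 2`, modulo the printed coefficient formula),
with `c_U > 0` the normalisation scalar of the product formula.

Blind lane: Mathlib + own prefix only; no sorry; axioms ⊆ {propext, Classical.choice, Quot.sound}.
-/

namespace Summit.Ventures.HodgeRepro2.T5U11CoefficientL2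

open MeasureTheory MeasureTheory.Measure Metric T5PoincareDensity T5SU11Unimodular T5U11Unimodular
  T5U11Product T5SU11Fibration T5SU11FibrationHaar T5SU11FibrationCartan T5SU11CoefficientL2
  T5SU11CoefficientPow T5HaarCircle
open Matrix hiding J
open scoped ENNReal NNReal Real

/-- The orbit map `g ↦ g · 0` on `U(1,1)` (the Möbius action of the matrix of `g`). -/
noncomputable def orbitU (g : U11) : ℂ := mobius ((g : GL (Fin 2) ℂ) : Matrix (Fin 2) (Fin 2) ℂ) 0

/-- Scalars act trivially on the disc: `mobius (λ • A) z = mobius A z` for `λ ≠ 0`. -/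
lemma mobius_smul (lam : ℂ) (hlam : lam ≠ 0) (A : Matrix (Fin 2) (Fin 2) ℂ) (z : ℂ) :
    mobius (lam • A) z = mobius A z := by
  unfold mobius
  simp only [Matrix.smul_apply, smul_eq_mul]
  rw [← mul_div_mul_left (A 0 0 * z + A 0 1) (A 1 0 * z + A 1 1) hlam]
  ring_nf

/-- `orbitU (scalarHom λ * g) = orbitU g`. -/
lemma orbitU_scalarHom_mul (lam : Circle) (g : U11) : orbitU (scalarHom lam * g) = orbitU g := by
  unfold orbitU
  rw [Subgroup.coe_mul, Units.val_mul, coe_scalarHom, smul_mul_assoc, Matrix.one_mul,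
    mobius_smul _ (coe_ne_zero lam)]

/-- `orbitU (incl h) = orbit h`. -/
lemma orbitU_incl (h : SU11) : orbitU (incl h) = orbit h := by
  unfold orbitU orbit
  rw [coe_incl]

/-- `orbitU (mulHom (λ, h)) = orbit h`. -/
lemma orbitU_mulHom (q : Circle × SU11) : orbitU (mulHom q) = orbit q.2 := by
  rw [mulHom_apply, orbitU_scalarHom_mul, orbitU_incl]

/-- `g · 0` lies in the disc for every `g ∈ U(1,1)` (`U(1,1) = Z · SU(1,1)`). -/
lemma orbitU_mem_ball (g : U11) : orbitU g ∈ ball (0 : ℂ) 1 := by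
  obtain ⟨q, hq⟩ := mulHom_surjective g
  rw [← hq, orbitU_mulHom]
  exact orbit_mem_ball q.2

/-- The denominator `g₁₁` of `g · 0` never vanishes on `U(1,1)` (`|g₀₁|² - |g₁₁|² = -1`). -/
lemma denom_ne_zero (g : U11) :
    ((g : GL (Fin 2) ℂ) : Matrix (Fin 2) (Fin 2) ℂ) 1 0 * 0 +
      ((g : GL (Fin 2) ℂ) : Matrix (Fin 2) (Fin 2) ℂ) 1 1 ≠ 0 := by
  rw [mul_zero, zero_add]
  intro h0
  have hmem := (mem_U11_iff (g : GL (Fin 2) ℂ)).mp g.2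
  have e := congr_fun (congr_fun hmem 1) 1
  simp [Matrix.mul_apply, Fin.sum_univ_two, T5UnitaryBound.J, h0] at e
  have e' : (starRingEnd ℂ) (((g : GL (Fin 2) ℂ) : Matrix (Fin 2) (Fin 2) ℂ) 0 1) *
      ((g : GL (Fin 2) ℂ) : Matrix (Fin 2) (Fin 2) ℂ) 0 1 = -1 := by
    linear_combination e
  have e2 : ((Complex.normSq (((g : GL (Fin 2) ℂ) : Matrix (Fin 2) (Fin 2) ℂ) 0 1) : ℝ) : ℂ) = -1 := by
    rw [Complex.normSq_eq_conj_mul_self]; exact e'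
  have e3 : Complex.normSq (((g : GL (Fin 2) ℂ) : Matrix (Fin 2) (Fin 2) ℂ) 0 1) = -1 := by
    exact_mod_cast e2
  linarith [Complex.normSq_nonneg (((g : GL (Fin 2) ℂ) : Matrix (Fin 2) (Fin 2) ℂ) 0 1)]

/-- `orbitU` is continuous. -/
lemma continuous_orbitU : Continuous orbitU := by
  have hc : Continuous fun g : U11 => ((g : GL (Fin 2) ℂ) : Matrix (Fin 2) (Fin 2) ℂ) :=
    Units.continuous_val.comp continuous_subtype_val
  have h00 := (continuous_apply (0 : Fin 2)).comp ((continuous_apply (0 : Fin 2)).comp hc)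
  have h01 := (continuous_apply (1 : Fin 2)).comp ((continuous_apply (0 : Fin 2)).comp hc)
  have h10 := (continuous_apply (0 : Fin 2)).comp ((continuous_apply (1 : Fin 2)).comp hc)
  have h11 := (continuous_apply (1 : Fin 2)).comp ((continuous_apply (1 : Fin 2)).comp hc)
  unfold orbitU mobius
  exact ((h00.mul continuous_const).add h01).div ((h10.mul continuous_const).add h11) denom_ne_zero

/-- `0 < 1 - |g·0|²` on `U(1,1)`. -/
lemma one_sub_normSq_orbitU_pos (g : U11) : 0 < 1 - ‖orbitU g‖ ^ 2 := by
  have := mem_ball_zero_iff.mp (orbitU_mem_ball g)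
  nlinarith [norm_nonneg (orbitU g)]

/-- The coefficient `(1 - |g·0|²)^{3p/2}` on `U(1,1)`. -/
noncomputable def coeffPowU (p : ℝ) (g : U11) : ℝ := (1 - ‖orbitU g‖ ^ 2) ^ (3 * p / 2)

/-- The squared coefficient `(1 - |g·0|²)³ = coeffPowU 2`. -/
noncomputable def coeffSqU (g : U11) : ℝ := (1 - ‖orbitU g‖ ^ 2) ^ 3

/-- `coeffSqU = coeffPowU 2`. -/
lemma coeffSqU_eq_coeffPowU : coeffSqU = coeffPowU 2 := by
  ext g
  unfold coeffSqU coeffPowU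
  rw [show (3 * (2 : ℝ) / 2) = ((3 : ℕ) : ℝ) by norm_num, Real.rpow_natCast]

/-- `coeffPowU p` is invariant under the scalar circle. -/
lemma coeffPowU_scalarHom_mul (p : ℝ) (lam : Circle) (g : U11) :
    coeffPowU p (scalarHom lam * g) = coeffPowU p g := by
  unfold coeffPowU
  rw [orbitU_scalarHom_mul]

/-- `coeffPowU p (incl h) = coeffPow p h`. -/
lemma coeffPowU_incl (p : ℝ) (h : SU11) : coeffPowU p (incl h) = coeffPow p h := by
  unfold coeffPowU coeffPow
  rw [orbitU_incl]

/-- `coeffPowU p (mulHom (λ, h)) = coeffPow p h`. -/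
lemma coeffPowU_mulHom (p : ℝ) (q : Circle × SU11) : coeffPowU p (mulHom q) = coeffPow p q.2 := by
  rw [mulHom_apply, coeffPowU_scalarHom_mul, coeffPowU_incl]

/-- `coeffPowU p` is continuous. -/
lemma continuous_coeffPowU (p : ℝ) : Continuous (coeffPowU p) := by
  unfold coeffPowU
  exact (continuous_const.sub (continuous_orbitU.norm.pow 2)).rpow_const
    fun g => Or.inl (one_sub_normSq_orbitU_pos g).ne'

variable [MeasurableSpace Circle] [BorelSpace Circle] [MeasurableSpace U11] [BorelSpace U11]

/-- **`coeffPowU p` is integrable against every Haar measure of `U(1,1)`** (`p > 2/3`). -/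
theorem integrable_coeffPowU (μU : Measure U11) [IsHaarMeasure μU] (p : ℝ) (hp : 2 / 3 < p) :
    Integrable (coeffPowU p) μU := by
  set c := haarScalarFactor (map mulHom (haarCircle.prod (nu haarCircle))) μU with hc
  have hc0 : c ≠ 0 := (T5U11Product.haarScalarFactor_pos haarCircle (nu haarCircle) μU).ne'
  have hmap : map mulHom (haarCircle.prod (nu haarCircle)) = c • μU :=
    map_mulHom_prod_eq_smul haarCircle (nu haarCircle) μU
  have hmeas : AEStronglyMeasurable (coeffPowU p) (map mulHom (haarCircle.prod (nu haarCircle))) :=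
    (continuous_coeffPowU p).aestronglyMeasurable
  have hint : Integrable (coeffPowU p) (map mulHom (haarCircle.prod (nu haarCircle))) := by
    rw [integrable_map_measure hmeas continuous_mulHom.measurable.aemeasurable]
    have e : (coeffPowU p ∘ mulHom) = fun q : Circle × SU11 => coeffPow p q.2 := by
      ext q
      exact coeffPowU_mulHom p q
    rw [e]
    exact (integrable_coeffPow (nu haarCircle) p hp).comp_snd haarCircle
  rw [hmap] at hint
  exact (integrable_smul_measure (ENNReal.coe_ne_zero.mpr hc0) ENNReal.coe_ne_top).mp hint

/-- **The integral over `U(1,1)`**: `c_U • ∫_{U(1,1)} (1 - |g·0|²)^{3p/2} dμU = 2π / (3p - 2)` for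
every Haar measure `μU` on `U(1,1)` and `p > 2/3`, with
`c_U = haarScalarFactor (map mulHom (haarCircle ⊗ ν)) μU > 0`. -/
theorem integral_coeffPowU (μU : Measure U11) [IsHaarMeasure μU] (p : ℝ) (hp : 2 / 3 < p) :
    (haarScalarFactor (map mulHom (haarCircle.prod (nu haarCircle))) μU : ℝ) •
      ∫ g, coeffPowU p g ∂μU = 2 * π / (3 * p - 2) := by
  rw [integral_eq_of_scalar_invariant haarCircle (nu haarCircle) μU (coeffPowU p)
    (integrable_coeffPowU μU p hp) (coeffPowU_scalarHom_mul p), haarCircle_univ, ENNReal.toReal_one,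
    one_smul]
  simp_rw [coeffPowU_incl]
  exact integral_coeffPow_nu p hp

/-- The integral is positive: P3's «`Z = ‖φ‖² ‖f‖² · vol(Z_j) κ_j / 2 > 0`» in the disc picture. -/
theorem integral_coeffPowU_pos (μU : Measure U11) [IsHaarMeasure μU] (p : ℝ) (hp : 2 / 3 < p) :
    0 < ∫ g, coeffPowU p g ∂μU := by
  have h := integral_coeffPowU μU p hp
  have hc : (0 : ℝ) < haarScalarFactor (map mulHom (haarCircle.prod (nu haarCircle))) μU := by
    exact_mod_cast T5U11Product.haarScalarFactor_pos haarCircle (nu haarCircle) μU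
  rw [smul_eq_mul] at h
  have hπ : (0 : ℝ) < 2 * π / (3 * p - 2) := by
    have : 0 < 3 * p - 2 := by linarith
    positivity
  rw [← h] at hπ
  exact pos_of_mul_pos_right hπ hc.le

/-- **Rühl's coordinates on `H_j = U(1,1)`**: for every Haar measure `μU` on `U(1,1)` and every
`μU`-integrable `F` invariant under the scalar circle,
`c_U • ∫_{U(1,1)} F dμU = ∫_{t>0} ∫_{θ∈(-π,π)} sinh t cosh t • ((2π)⁻¹ ∫_0^{2π} F (incl (s(tanh t e^{iθ}) rot e^{iψ})) dψ)`
(the product formula `U(1,1) = Z · SU(1,1)` composed with `integral_eq_cartan` for `ν`). -/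
theorem integral_eq_cartan_U (μU : Measure U11) [IsHaarMeasure μU] {E : Type*} [NormedAddCommGroup E]
    [NormedSpace ℝ E] [CompleteSpace E] (F : U11 → E) (hF : Integrable F μU)
    (hinv : ∀ (lam : Circle) (g : U11), F (scalarHom lam * g) = F g) :
    (haarScalarFactor (map mulHom (haarCircle.prod (nu haarCircle))) μU : ℝ) • ∫ g, F g ∂μU =
      ∫ q in Set.Ioi (0 : ℝ) ×ˢ Set.Ioo (-π) π, (Real.sinh q.1 * Real.cosh q.1) •
        ((2 * π)⁻¹ • ∫ ψ in (0 : ℝ)..2 * π,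
          F (incl (sec ((Real.tanh q.1 : ℂ) * ((Real.cos q.2 : ℂ) + (Real.sin q.2 : ℂ) * Complex.I)) *
            rot (Circle.exp ψ)))) := by
  rw [integral_eq_of_scalar_invariant haarCircle (nu haarCircle) μU F hF hinv, haarCircle_univ,
    ENNReal.toReal_one, one_smul]
  -- `F ∘ incl` is `ν`-integrable: from the product formula
  have hint : Integrable (fun h : SU11 => F (incl h)) (nu haarCircle) := by
    set c := haarScalarFactor (map mulHom (haarCircle.prod (nu haarCircle))) μU with hc
    have hc0 : c ≠ 0 := (T5U11Product.haarScalarFactor_pos haarCircle (nu haarCircle) μU).ne'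
    have hmap : map mulHom (haarCircle.prod (nu haarCircle)) = c • μU :=
      map_mulHom_prod_eq_smul haarCircle (nu haarCircle) μU
    have hF' : Integrable F (map mulHom (haarCircle.prod (nu haarCircle))) := by
      rw [hmap]; exact hF.smul_measure ENNReal.coe_ne_top
    have hprod : Integrable (F ∘ mulHom) (haarCircle.prod (nu haarCircle)) :=
      (integrable_map_measure hF'.aestronglyMeasurable continuous_mulHom.measurable.aemeasurable).mp hF'
    have e : (F ∘ mulHom) = fun q : Circle × SU11 => F (incl q.2) := by
      ext q
      rw [Function.comp_apply, mulHom_apply, hinv]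
    rw [e] at hprod
    exact (Integrable.comp_snd_iff (μ := haarCircle) (NeZero.ne _)).mp hprod
  have h := integral_eq_cartan (nu haarCircle) (fun h => F (incl h)) hint
  rw [haarScalarFactor_self, NNReal.coe_one, one_smul] at h
  exact h

/-- The `L²`-case (`p = 2`): `c_U • ∫_{U(1,1)} (1 - |g·0|²)³ dμU = π / 2`. -/
theorem integral_coeffSqU (μU : Measure U11) [IsHaarMeasure μU] :
    (haarScalarFactor (map mulHom (haarCircle.prod (nu haarCircle))) μU : ℝ) •
      ∫ g, coeffSqU g ∂μU = π / 2 := by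
  rw [coeffSqU_eq_coeffPowU, integral_coeffPowU μU 2 (by norm_num)]
  ring

end Summit.Ventures.HodgeRepro2.T5U11CoefficientL2
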